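import Summits.HodgeConjecture.CorCM.GaloisNonNormalPrimeOrder
import Mathlib.LinearAlgebra.Matrix.SpecialLinearGroup
import HarnessLib

/-!
# TABLE-MODEL bridges for the prime-order skew criteria, and `Gal(K/ℚ) ≅ SL(2,3) ∘ C₄` (central product, order `48`): simple
# DEGENERATE CM abelian 24-folds

COR-CM (cell `pub-hodgecm2`), binder seat b04 (gen 33), count-neutral own lane «Galois-CM-type classification».  KERNEL ONLY:
theorems; no definition, no named fact, no `sorry`.  `HC_CM` is neither used nor claimed.  Groups without a Mathlib model enter the
seat's files as TABLES (a bijection `e : Gal(K/ℚ) ≃ X` with an explicit law, gens 17–28); this file transports two criteria of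
`CorCM/GaloisNonNormalPrimeOrder` (gen 33) through such a table, so that their hypotheses become `decide` goals on `X`:

* `exists_simple_degenerate_of_table_involution_three_conjugates` — order `48`, an involution `xu` and `x₁, x₂` (with table
  inverses `x₁', x₂'`) exhibiting three conjugates ⟹ BAD (dimension `24`).
* `exists_simple_degenerate_of_table_nonnormal_order_three` — `|X| ≥ 84`, `xu` of order `3` and `xg` (inverse `xg'`) with
  `xg xu xg' ∉ {1, xu, xu²}` ⟹ BAD (dimension `|X|/2`).
* `exists_simple_degenerate_of_table_sl_two_three_central_four` — **`Gal(K/ℚ) ≅ SL(2,3) ∘ C₄ = (SL(2,3) × C₄)/⟨(-1, t²)⟩`** as the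
  table `SL(2, ZMod 3) × ZMod 2`, `(A, s)(B, s') = (±AB, s + s')` (sign `-` iff `s = s' = 1`) **⟹ a simple DEGENERATE abelian
  `24`-fold with CM by `K`**: the images of `(a, t)` (`a` of order `4`) are non-central involutions with `6` conjugates.  This group
  (centre `C₄`, unique central involution; every normal subgroup `≠ 1` contains it) has NO proper CM quotient, no imaginary
  quadratic subfield, no totally real factor, no abelian subgroup of index two — outside every criterion of gens 19–32 and not a
  consequence of the `A₄ × C₄` certificate.

## References

* [Shimura1998] G. Shimura, *Abelian Varieties with Complex Multiplication and Modular Functions*, §6.2 Thm. 3, §8.2 Prop. 26, §32.10.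
* [Gordon1999HodgeAVSurvey] B. B. Gordon, *A survey of the Hodge conjecture for abelian varieties*, Thm. 6.4, §9.3.
-/

noncomputable section

open CategoryTheory CategoryTheory.Limits NumberField
open scoped BigOperators MatrixGroups

namespace Summit.HodgeConjecture.CorCM.GaloisModels

open Literature.NumberTheory.ComplexMultiplication
open Literature.AlgebraicGeometry.Motives (AbelianVariety CMType)
open Literature.AlgebraicGeometry.HodgeTheory
open Literature.AlgebraicGeometry.ComplexMultiplication (IsCMTypeRealisation)
open Literature.AlgebraicGeometry.Pohlmann1968
open Literature.Barriers.HodgeConjecture (divisorClassesSpan)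
open Summit.HodgeConjecture.CorCM.GaloisRank

variable {K : Type} [Field K] [NumberField K] [IsCMField K] [IsGalois ℚ K]

/-- **TABLE-MODEL BRIDGE for «order `48`, an involution with three conjugates»**: `e : Gal(K/ℚ) ≃ X` a bijection with
`e(ab) = mul (e a) (e b)`, `one` the only idempotent, and `xu, x₁, x₁', x₂, x₂' ∈ X` with `xu² = one`, `x₁x₁' = one = x₂x₂'`,
`xu x₁ ≠ x₁ xu`, `xu x₂ ≠ x₂ xu`, `x₁ xu x₁' ≠ x₂ xu x₂'`, `|X| = 48` ⟹ a simple DEGENERATE abelian `24`-fold with CM by `K`.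
[cite: Shimura1998, §6.2 Thm. 3, §8.2 Prop. 26 and §32.10] [cite: Gordon1999HodgeAVSurvey, Thm. 6.4 and §9.3] -/
theorem exists_simple_degenerate_of_table_involution_three_conjugates {X : Type*} [Fintype X] [DecidableEq X]
    (e : (K ≃ₐ[ℚ] K) ≃ X) (mul : X → X → X) (hmul : ∀ a b : K ≃ₐ[ℚ] K, e (a * b) = mul (e a) (e b)) (one : X)
    (hidem : ∀ x : X, mul x x = x → x = one) (xu x₁ x₁' x₂ x₂' : X) (huu : mul xu xu = one) (hx₁ : mul x₁ x₁' = one)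
    (hx₂ : mul x₂ x₂' = one) (h1 : mul xu x₁ ≠ mul x₁ xu) (h2 : mul xu x₂ ≠ mul x₂ xu)
    (h12 : mul (mul x₁ xu) x₁' ≠ mul (mul x₂ xu) x₂') (hcard : Fintype.card X = 48) :
    ∃ (Φ : CMType K) (φ₀ : K →+* ℂ) (A : AbelianVariety ℂ) (ι : 𝓞 K →+* End A)
      (θ : K →+* Module.End ℂ (complexBetti A.X 1)),
      IsPrimitive (ℂ ≃+* ℂ) Φ.1 φ₀ ∧ ¬ IsNondegenerate Φ ∧ IsCMTypeRealisation Φ A ι θ ∧ A.IsSimple ∧ A.dim = 24 ∧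
      ∃ n p : ℕ, ∃ x : complexBetti (⨁ fun _ : Fin n => A).X (2 * p), IsRationalClass x ∧
        IsOfHodgeType (⨁ fun _ : Fin n => A).dim (⨁ fun _ : Fin n => A).X (2 * p) p p x ∧
        x ∉ divisorClassesSpan (⨁ fun _ : Fin n => A).X (⨁ fun _ : Fin n => A).dim p := by
  classical
  have hone : e 1 = one := hidem _ (by rw [← hmul, mul_one])
  have hsymm : ∀ x : X, e (e.symm x) = x := fun x => e.apply_symm_apply x
  set u := e.symm xu with hu
  set g₁ := e.symm x₁ with hg₁
  set g₂ := e.symm x₂ with hg₂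
  have hinv : ∀ (g : K ≃ₐ[ℚ] K) (y y' : X), e g = y → mul y y' = one → e g⁻¹ = y' := by
    intro g y y' hg hy
    have h : g * e.symm y' = 1 := e.injective (by rw [hmul, hg, hsymm, hy, hone])
    rw [← eq_inv_of_mul_eq_one_right h, hsymm]
  have huu' : u * u = 1 := e.injective (by rw [hmul, hu, hsymm, huu, hone])
  have h1' : g₁⁻¹ * u * g₁ ≠ u := by
    intro h
    have hc : u * g₁ = g₁ * u := by
      calc u * g₁ = g₁ * (g₁⁻¹ * u * g₁) := by group
        _ = g₁ * u := by rw [h]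
    exact h1 (by rw [← hsymm xu, ← hsymm x₁, ← hu, ← hg₁, ← hmul, ← hmul, hc])
  have h2' : g₂⁻¹ * u * g₂ ≠ u := by
    intro h
    have hc : u * g₂ = g₂ * u := by
      calc u * g₂ = g₂ * (g₂⁻¹ * u * g₂) := by group
        _ = g₂ * u := by rw [h]
    exact h2 (by rw [← hsymm xu, ← hsymm x₂, ← hu, ← hg₂, ← hmul, ← hmul, hc])
  have h12' : g₂⁻¹ * g₁ * u * (g₂⁻¹ * g₁)⁻¹ ≠ u := by
    intro h
    have hc : g₁ * u * g₁⁻¹ = g₂ * u * g₂⁻¹ := by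
      calc g₁ * u * g₁⁻¹ = g₂ * (g₂⁻¹ * g₁ * u * (g₂⁻¹ * g₁)⁻¹) * g₂⁻¹ := by group
        _ = g₂ * u * g₂⁻¹ := by rw [h]
    apply h12
    rw [← hsymm xu, ← hsymm x₁, ← hsymm x₂, ← hu, ← hg₁, ← hg₂, ← hmul, ← hmul,
      ← hinv g₁ x₁ x₁' (by rw [hg₁, hsymm]) hx₁, ← hinv g₂ x₂ x₂' (by rw [hg₂, hsymm]) hx₂, ← hmul, ← hmul, hc]
  have hcardG : Fintype.card (K ≃ₐ[ℚ] K) = 48 := by rw [Fintype.card_congr e, hcard]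
  obtain ⟨Φ, φ₀, A, ι, θ, H1, H2, H3, H4, H5, H6⟩ := exists_simple_degenerate_of_involution_three_conjugates
    (MulEquiv.refl (K ≃ₐ[ℚ] K)) u g₁ g₂ huu' h1' h2' h12' hcardG
  exact ⟨Φ, φ₀, A, ι, θ, H1, H2, H3, H4, H5, H6⟩

/-- **TABLE-MODEL BRIDGE for «a non-normal subgroup of order 3, `|G| ≥ 84`»**: `e : Gal(K/ℚ) ≃ X` with `e(ab) = mul (e a) (e b)`,
`one` the only idempotent, `xu` with `xu³ = one ≠ xu`, and `xg, xg'` with `xg xg' = one` and `xg xu xg' ∉ {one, xu, xu²}`, `|X| ≥ 84`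
⟹ a simple DEGENERATE abelian variety of dimension `|X|/2` with CM by `K`.
[cite: Shimura1998, §6.2 Thm. 3, §8.2 Prop. 26 and §32.10] [cite: Gordon1999HodgeAVSurvey, Thm. 6.4 and §9.3] -/
theorem exists_simple_degenerate_of_table_nonnormal_order_three {X : Type*} [Fintype X] [DecidableEq X]
    (e : (K ≃ₐ[ℚ] K) ≃ X) (mul : X → X → X) (hmul : ∀ a b : K ≃ₐ[ℚ] K, e (a * b) = mul (e a) (e b)) (one : X)
    (hidem : ∀ x : X, mul x x = x → x = one) (xu xg xg' : X) (hu3 : mul (mul xu xu) xu = one) (hu1 : xu ≠ one)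
    (hg : mul xg xg' = one) (hn0 : mul (mul xg xu) xg' ≠ one) (hn1 : mul (mul xg xu) xg' ≠ xu)
    (hn2 : mul (mul xg xu) xg' ≠ mul xu xu) (hcard : 84 ≤ Fintype.card X) :
    ∃ (Φ : CMType K) (φ₀ : K →+* ℂ) (A : AbelianVariety ℂ) (ι : 𝓞 K →+* End A)
      (θ : K →+* Module.End ℂ (complexBetti A.X 1)),
      IsPrimitive (ℂ ≃+* ℂ) Φ.1 φ₀ ∧ ¬ IsNondegenerate Φ ∧ IsCMTypeRealisation Φ A ι θ ∧ A.IsSimple ∧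
      A.dim = Fintype.card X / 2 ∧
      ∃ n p : ℕ, ∃ x : complexBetti (⨁ fun _ : Fin n => A).X (2 * p), IsRationalClass x ∧
        IsOfHodgeType (⨁ fun _ : Fin n => A).dim (⨁ fun _ : Fin n => A).X (2 * p) p p x ∧
        x ∉ divisorClassesSpan (⨁ fun _ : Fin n => A).X (⨁ fun _ : Fin n => A).dim p := by
  classical
  have hone : e 1 = one := hidem _ (by rw [← hmul, mul_one])
  have hsymm : ∀ x : X, e (e.symm x) = x := fun x => e.apply_symm_apply x
  set u := e.symm xu with hu
  set g := e.symm xg with hgdef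
  have hginv : e g⁻¹ = xg' := by
    have h : g * e.symm xg' = 1 := e.injective (by rw [hmul, hgdef, hsymm, hsymm, hg, hone])
    rw [← eq_inv_of_mul_eq_one_right h, hsymm]
  have heu : e u = xu := by rw [hu, hsymm]
  have heu2 : e (u ^ 2) = mul xu xu := by rw [pow_two, hmul, heu]
  have hu3' : u ^ 3 = 1 := e.injective (by rw [pow_succ, hmul, heu2, heu, hu3, hone])
  have hu1' : u ≠ 1 := fun h => hu1 (by rw [← heu, h, hone])
  have hconj : e (g * u * g⁻¹) = mul (mul xg xu) xg' := by rw [hmul, hmul, hgdef, hsymm, heu, ← hgdef, hginv]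
  have hnn : ∃ g : K ≃ₐ[ℚ] K, ∀ k < 3, g * u * g⁻¹ ≠ u ^ k := by
    refine ⟨g, fun k hk h => ?_⟩
    interval_cases k
    · exact hn0 (by rw [← hconj, h, pow_zero, hone])
    · exact hn1 (by rw [← hconj, h, pow_one, heu])
    · exact hn2 (by rw [← hconj, h, heu2])
  have hcardG : 84 ≤ Fintype.card (K ≃ₐ[ℚ] K) := by rw [Fintype.card_congr e]; exact hcard
  obtain ⟨Φ, φ₀, A, ι, θ, H1, H2, H3, H4, H5, H6⟩ :=
    exists_simple_degenerate_of_nonnormal_order_three (MulEquiv.refl (K ≃ₐ[ℚ] K)) u hu3' hu1' hnn hcardG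
  exact ⟨Φ, φ₀, A, ι, θ, H1, H2, H3, H4, by rw [H5, Fintype.card_congr e], H6⟩

/-- `SL(2,3) ∘ C₄` as the table `SL(2, ZMod 3) × ZMod 2`, `(A, s)(B, s') = (±AB, s + s')` (sign `-` iff `s = s' = 1`): the only
idempotent is `(1, 0)`, and `xu = ((0 1; 2 0), 1)`, `x₁ = ((0 1; 2 1), 0)`, `x₂ = ((0 1; 2 2), 0)` with their inverses satisfy the
five relations of the bridge. [folklore] -/
theorem sl_two_three_central_four_table_certificate :
    (∀ x : SL(2, ZMod 3) × ZMod 2, (if x.2 = 1 ∧ x.2 = 1 then -(x.1 * x.1) else x.1 * x.1, x.2 + x.2) = x →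
      x = ((1 : SL(2, ZMod 3)), (0 : ZMod 2))) ∧
    (let mul : SL(2, ZMod 3) × ZMod 2 → SL(2, ZMod 3) × ZMod 2 → SL(2, ZMod 3) × ZMod 2 :=
        fun x y => (if x.2 = 1 ∧ y.2 = 1 then -(x.1 * y.1) else x.1 * y.1, x.2 + y.2)
      let xu : SL(2, ZMod 3) × ZMod 2 := ((show SL(2, ZMod 3) from ⟨!![0, 1; 2, 0], by decide⟩), 1)
      let x₁ : SL(2, ZMod 3) × ZMod 2 := ((show SL(2, ZMod 3) from ⟨!![0, 1; 2, 1], by decide⟩), 0)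
      let x₁' : SL(2, ZMod 3) × ZMod 2 := ((show SL(2, ZMod 3) from ⟨!![1, 2; 1, 0], by decide⟩), 0)
      let x₂ : SL(2, ZMod 3) × ZMod 2 := ((show SL(2, ZMod 3) from ⟨!![0, 1; 2, 2], by decide⟩), 0)
      let x₂' : SL(2, ZMod 3) × ZMod 2 := ((show SL(2, ZMod 3) from ⟨!![2, 2; 1, 0], by decide⟩), 0)
      mul xu xu = (1, 0) ∧ mul x₁ x₁' = (1, 0) ∧ mul x₂ x₂' = (1, 0) ∧ mul xu x₁ ≠ mul x₁ xu ∧ mul xu x₂ ≠ mul x₂ xu ∧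
        mul (mul x₁ xu) x₁' ≠ mul (mul x₂ xu) x₂') ∧
    Fintype.card (SL(2, ZMod 3) × ZMod 2) = 48 := by
  refine ⟨by decide, by decide, ?_⟩
  rw [Fintype.card_prod, ZMod.card, show Fintype.card (SL(2, ZMod 3)) = 24 from rfl]

/-- **`Gal(K/ℚ) ≅ SL(2,3) ∘ C₄` (table model): a simple DEGENERATE abelian `24`-fold with CM by `K`**, with a rational `(q,q)`
class outside the divisor ring on some power. [cite: Shimura1998, §6.2 Thm. 3, §8.2 Prop. 26 and §32.10]
[cite: Gordon1999HodgeAVSurvey, Thm. 6.4 and §9.3] -/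
theorem exists_simple_degenerate_of_table_sl_two_three_central_four (e : (K ≃ₐ[ℚ] K) ≃ SL(2, ZMod 3) × ZMod 2)
    (hmul : ∀ a b : K ≃ₐ[ℚ] K, e (a * b) =
      (if (e a).2 = 1 ∧ (e b).2 = 1 then -((e a).1 * (e b).1) else (e a).1 * (e b).1, (e a).2 + (e b).2)) :
    ∃ (Φ : CMType K) (φ₀ : K →+* ℂ) (A : AbelianVariety ℂ) (ι : 𝓞 K →+* End A)
      (θ : K →+* Module.End ℂ (complexBetti A.X 1)),
      IsPrimitive (ℂ ≃+* ℂ) Φ.1 φ₀ ∧ ¬ IsNondegenerate Φ ∧ IsCMTypeRealisation Φ A ι θ ∧ A.IsSimple ∧ A.dim = 24 ∧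
      ∃ n p : ℕ, ∃ x : complexBetti (⨁ fun _ : Fin n => A).X (2 * p), IsRationalClass x ∧
        IsOfHodgeType (⨁ fun _ : Fin n => A).dim (⨁ fun _ : Fin n => A).X (2 * p) p p x ∧
        x ∉ divisorClassesSpan (⨁ fun _ : Fin n => A).X (⨁ fun _ : Fin n => A).dim p := by
  classical
  obtain ⟨hidem, ⟨huu, hx₁, hx₂, h1, h2, h12⟩, hcard⟩ := sl_two_three_central_four_table_certificate
  exact exists_simple_degenerate_of_table_involution_three_conjugates e
    (fun x y => (if x.2 = 1 ∧ y.2 = 1 then -(x.1 * y.1) else x.1 * y.1, x.2 + y.2)) hmul ((1 : SL(2, ZMod 3)), 0)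
    hidem _ _ _ _ _ huu hx₁ hx₂ h1 h2 h12 hcard

end Summit.HodgeConjecture.CorCM.GaloisModels

end
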